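import Summits.QuantumFields.YangMills.Theorems.BalabanUVNodesN15KingModelFullPropagatorRateProfile
import Summits.QuantumFields.YangMills.Theorems.BalabanUVNodesN15KingModelFullPropagatorGradProfile
import Summits.QuantumFields.YangMills.Theorems.BalabanUVNodesN15KingModelFullPropagatorGradRate

/-!
# BalabanUVNodes ∕ N15 — THE KING-MODEL RUNG, CURVED EDITION (PART S-c): THE TWO-SPACING η-RATE PROFILE OF THE GRADIENT
# `∂^η_μG^η_K` OF THE FULL `A = 0` FLUCTUATION PROPAGATOR, ALL PAIRS — the (3.73) SECOND line summed over (2.17):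
# `|∂^{η′}_μG^{η′}_{K+n}(x′, y′) − ∂^η_μG^η_K(x, y)| ≤ C·[θ^K·Σ_{i<K} (ΛL·L^{γ∕2})^i e^{−δ r′L^i∕N′} + Σ_{i<n} (ΛL)^{K+i} e^{−δ r′L^{K+i}∕N′}]`
# (Track A, DAG node N15 = NE2; FAN-OUT v1.1 §N15 s3 «KING-MODEL RUNG … + the one-line statement of what the curved case adds»)

HONEST FRAMING.  Count-neutral kernel bookkeeping (cell `pub-ymgap`, seat `pub-ymgap-dag-n15-e` g8; `--supports stmt-QuantumFields-20296
--as helper` = K3⁵ `SpineGivenEndpointR13SepCoP`, WORDS-141).  TEMPLATE LITERATURE, `A = 0`: C. King's scalar U(1)-Higgs MODEL on finite tori ([King1986]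
§2.2 p. 653 (2.13)–(2.17), p. 654 (2.20), Prop. 3.8 (3.71) p. 664 and Prop. 3.9 (3.73) p. 665 second line «`|∂^{η′}_μG^{η′}_{(j)}(x′, y′) −
∂^η_μG^η_{(j)}(x, y)| ≤ CL^{−γk}(L^jη)^{1−d−γ}exp[−δ₀(L^jη)^{−1}|x − y|]`», King's `d` = this file's `d + 1`), NOT Bałaban's covariant objects; the
statement below is the (2.17)-SUMMED SHAPE of (3.73) line 2 for King's (2.13) at `A = 0`, NOT a printed proposition; NE2⁺ is NOT PRINTED and not
proved here; NOT a node discharge; nothing continuum ∕ ℝ⁴ ∕ OS ∕ mass-gap ∕ Clay.  0 `sorry`, 0 `def`, standard axioms.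

THE POINT.  Part S-a (`fullProp_rateProfile_unif`) proved the all-pairs two-spacing rate profile of the KERNEL; part O-b′ (`fullPropD_rate_unif`)
the off-diagonal unit-scale rate of the GRADIENT.  THIS FILE is part S-a's paired induction on the DIFFERENTIATED peels (part O-b′
`fullPropD_peel_pair_abs_le`, per-level factor `ΛL = (L^{d+1}∕L²)·L`), for the forward η-derivatives in the observation point
`∂G′ := L^nL^K·[G′(x′ + e_μ, y′) − G′(x′, y′)]`, `∂G := L^K·[G(x + e_μ, y) − G(x, y)]` (`x = underPtN x′`):
* ★★ **`fullPropD_rateProfile_unif`** — for `0 ≤ γ < 1`: `∃ C, δ > 0 ∀ K ≥ 1 ∀ n ≥ 1 ∀ cube 2L^e ∀ 0 < m² ≤ m₀² ∀ μ ∀ x′ y′` (ALL pairs;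
  `r′` the fine distance, `N′ = L^nL^K`, `θ = L^{−γ∕2}`):
  `|∂G′(x′, y′) − ∂G(x, y)| ≤ C·[θ^K·Σ_{i<K} (ΛL·L^{γ∕2})^i·e^{−δ·r′·L^i∕N′} + Σ_{i<n} (ΛL)^{K+i}·e^{−δ·r′·L^{K+i}∕N′}]` — paired levels with
  King's rate at their own scale `θ^{K−i}`, the `n` unpaired fine levels in full (base = part R-c `fullPropD_profile_unif` for BOTH runs;
  step = part O-b′'s pair of differentiated peels + part M′ `ksDSlice_rate_unif` read in fine distance + IH; `θ^{K+1}·(ΛL·L^{γ∕2}) = θ^K·ΛL`).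
  The closed form `C|x′−y′|^{1−(d+1)}(η∕|x′−y′|)^{γ∕2}` for `|x′ − y′| ≥ η` — the (W1)-type gradient profile WITH the scale-covariant rate
  factor — is part S-d.
WHAT THE CURVED CASE ADDS (one line): the same for Bałaban's `∇_UG_k(U)` pair uniformly over `Reg335` (not printed as an η-difference).
HONEST SCOPE.  (i) `A = 0`, periodic b.c., odd `L ≥ 3`, `0 < m² ≤ m₀²`, cubes `2L^e`; (ii) lattice units of the respective levels; (iii) `K, n ≥ 1`;
(iv) `0 ≤ γ < 1` (part M′'s gradient-piece rate); (v) not Bałaban's `∇G_k(U)`; not a discharge.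
Locators: [King1986] C. King, CMP **102** (1986) 649–677: (2.13)–(2.17) p. 653, (2.20) p. 654, Theorem 3.3 p. 655, (3.7) p. 656, Prop. 3.7
(3.63) p. 663, Prop. 3.8 (3.71) p. 664, Prop. 3.9 (3.73) p. 665, (4.42)–(4.43) p. 675; [B9] = [Balaban1985BackgroundPropagators] Thm 3.14
pp. 426–427 (template).
-/

noncomputable section

namespace Summit.QuantumFields.YangMills.BalabanUVNodes.N15KingModelRung.Curved

open Real Finset Matrix
open Literature.MathematicalPhysics.QuantumFieldTheory.Balaban1983to89.B5Prop11Plancherel (Tor fine unitVec)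
open Literature.MathematicalPhysics.QuantumFieldTheory.King1986 (aK aK_pos)
open Literature.MathematicalPhysics.QuantumFieldTheory.King1986.Torus (constrainedProp flatten blockOf tdistT torCongr
  tdistT_torCongr blockOf_flatten tdistT_nonneg)

variable {d : ℕ} (L : ℕ) [NeZero L]

/-- **THE TWO-SPACING η-RATE PROFILE OF THE GRADIENT OF KING'S FULL `A = 0` FLUCTUATION PROPAGATOR, ALL PAIRS** (Prop. 3.9 (3.73) line 2
summed over (2.17)): for odd `L ≥ 3`, `a > 0`, a mass cap `m₀² ≥ 0` and `0 ≤ γ < 1` there are `C, δ > 0` (functions of `d, L, a, m₀², γ`) such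
that for EVERY `K ≥ 1`, `n ≥ 1`, cube `M_μ = 2L^e`, mass `0 < m² ≤ m₀²`, direction `μ` and ALL fine points `x′, y′` of the `(K+n)`-level run
(`x = underPtN x′`, `y = underPtN y′`, `r′ = |x′ − y′|_{fine L^nL^K M}`, `N′ = L^nL^K`, `ΛL = (L^{d+1}∕L²)·L`, `θ = L^{−γ∕2}`):
`|L^nL^K[G′(x′+e_μ, y′) − G′(x′, y′)] − L^K[G(x+e_μ, y) − G(x, y)]| ≤ C·[θ^K·Σ_{i<K} (ΛL·L^{γ∕2})^i·exp(−δ·r′·L^i∕N′) + Σ_{i<n} (ΛL)^{K+i}·exp(−δ·r′·L^{K+i}∕N′)]`.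
Paired induction on `K` (module docstring). [cite: King1986, (2.13)–(2.17) p.653, (2.20) p.654, Prop. 3.7 (3.63) p.663, Prop. 3.8 (3.71) p.664, Prop. 3.9 (3.73) p.665, (4.42)–(4.43) p.675] -/
theorem fullPropD_rateProfile_unif (hLodd : Odd L) (hL : 2 ≤ L) {a : ℝ} (ha : 0 < a) {m0sq : ℝ} (hm0 : 0 ≤ m0sq) {γ : ℝ}
    (hγ0 : 0 ≤ γ) (hγ1 : γ < 1) :
    ∃ C δ : ℝ, 0 < C ∧ 0 < δ ∧ ∀ (K : ℕ), 1 ≤ K → ∀ (n : ℕ), 1 ≤ n →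
      ∀ (e : ℕ) (M : Fin (d + 1) → ℕ) [∀ μ, NeZero (M μ)], (∀ μ, M μ = 2 * L ^ e) →
      ∀ (msq : ℝ), 0 < msq → msq ≤ m0sq →
      ∀ (μ : Fin (d + 1)) (x' y' : Tor (fine (L ^ n * L ^ K) M)),
        |((L ^ n * L ^ K : ℕ) : ℝ) *
              (constrainedProp (L ^ n * L ^ K) M (aK a L (K + n)) (((L ^ n * L ^ K : ℕ) : ℝ) ^ 2) msq
                  (x' + unitVec (fine (L ^ n * L ^ K) M) μ) y'
                - constrainedProp (L ^ n * L ^ K) M (aK a L (K + n)) (((L ^ n * L ^ K : ℕ) : ℝ) ^ 2) msq x' y')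
            - ((L ^ K : ℕ) : ℝ) *
              (constrainedProp (L ^ K) M (aK a L K) (((L ^ K : ℕ) : ℝ) ^ 2) msq
                  (underPtN L K n M x' + unitVec (fine (L ^ K) M) μ) (underPtN L K n M y')
                - constrainedProp (L ^ K) M (aK a L K) (((L ^ K : ℕ) : ℝ) ^ 2) msq
                  (underPtN L K n M x') (underPtN L K n M y'))|
          ≤ C * ((((L : ℝ) ^ (-(γ / 2))) ^ K)
                  * ∑ i ∈ Finset.range K, ((L : ℝ) ^ (d + 1) / (L : ℝ) ^ 2 * L * (L : ℝ) ^ (γ / 2)) ^ i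
                      * Real.exp (-(δ * (tdistT (fine (L ^ n * L ^ K) M) x' y' * (L : ℝ) ^ i / ((L ^ n * L ^ K : ℕ) : ℝ))))
                + ∑ i ∈ Finset.range n, ((L : ℝ) ^ (d + 1) / (L : ℝ) ^ 2 * L) ^ (K + i)
                      * Real.exp (-(δ * (tdistT (fine (L ^ n * L ^ K) M) x' y' * (L : ℝ) ^ (K + i)
                          / ((L ^ n * L ^ K : ℕ) : ℝ))))) := by
  have hL1 : 1 < L := by omega
  have hL1n : 1 ≤ L := hL1.le
  have hLr : (1 : ℝ) ≤ L := by exact_mod_cast hL1n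
  have hL0 : (0 : ℝ) < L := by positivity
  -- the rate `θ = L^{−γ∕2} ∈ [L⁻¹, 1]` and its inverse `L^{γ∕2}`
  set θ : ℝ := (L : ℝ) ^ (-(γ / 2)) with hθdef
  set φ : ℝ := (L : ℝ) ^ (γ / 2) with hφdef
  have hθ0 : 0 < θ := Real.rpow_pos_of_pos hL0 _
  have hφ0 : 0 < φ := Real.rpow_pos_of_pos hL0 _
  have hθφ : θ * φ = 1 := theta_mul_rpow L hL1n γ
  have hθL : (L : ℝ)⁻¹ ≤ θ := inv_le_theta L hL1n hγ1.le
  -- part R-a (both runs at the base) and part M's slice rate (the step)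
  obtain ⟨Ca, δa, hCa, hδa, Ha⟩ := fullPropD_profile_unif (d := d) L hLodd hL ha hm0
  obtain ⟨Cr, κ, hCr, hκ, Hr⟩ := ksDSlice_rate_unif (d := d) L hLodd hL ha hm0 hγ0 hγ1
  -- the constants of the theorem
  set Λ : ℝ := (L : ℝ) ^ (d + 1) / (L : ℝ) ^ 2 * L with hΛdef
  have hΛ : 0 < Λ := by positivity
  set Λ' : ℝ := Λ * φ with hΛ'def
  have hΛ' : 0 < Λ' := mul_pos hΛ hφ0
  have hθΛ' : θ * Λ' = Λ := by
    rw [hΛ'def, mul_left_comm, hθφ, mul_one]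
  set δ : ℝ := min δa κ with hδdef
  have hδ : 0 < δ := lt_min hδa hκ
  have hδa' : δ ≤ δa := min_le_left _ _
  have hδκ : δ ≤ κ := min_le_right _ _
  set C : ℝ := max (max (Ca * (1 + Real.exp δa) * L) Ca) (Λ * Cr * Real.exp κ * L) with hCdef
  have hC : 0 < C := lt_max_of_lt_left (lt_max_of_lt_right hCa)
  have hC1 : Ca * (1 + Real.exp δa) * L ≤ C := (le_max_left _ _).trans (le_max_left _ _)
  have hC2 : Ca ≤ C := (le_max_right _ _).trans (le_max_left _ _)
  have hC3 : Λ * Cr * Real.exp κ * L ≤ C := le_max_right _ _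
  -- `X·L ≤ C ⇒ X ≤ C·θ` (the spare power `L⁻¹ ≤ θ`)
  have hspare : ∀ X : ℝ, 0 ≤ X → X * L ≤ C → X ≤ C * θ := fun X hX hXL => by
    calc X = X * L * (L : ℝ)⁻¹ := by field_simp
      _ ≤ C * θ := mul_le_mul hXL hθL (inv_pos.mpr hL0).le hC.le
  refine ⟨C, δ, hC, hδ, ?_⟩
  intro K hK
  induction K, hK using Nat.le_induction with
  | base =>
    -- `K = 1`: part R-a's profile for BOTH runs; level `0` of the fine run pairs with the coarse run's single level
    intro n hn e M _ hM msq hmsq hcap μ x' y'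
    set u := underPtN L 1 n M x' with hu
    set v := underPtN L 1 n M y' with hv
    -- the fine run: a `(1+n)`-level propagator, ALL its levels; the coarse run: one level
    have hfine := Ha (1 + n) (by omega) (L ^ n * L ^ 1) (by rw [pow_add, mul_comm]) e M hM msq hmsq hcap μ x' y'
    have hcoarse := Ha 1 le_rfl (L ^ 1) rfl e M hM msq hmsq hcap μ u v
    set r' : ℝ := tdistT (fine (L ^ n * L ^ 1) M) x' y' with hr'def
    set r : ℝ := tdistT (fine (L ^ 1) M) u v with hrdef
    set N1 : ℝ := ((L ^ n * L ^ 1 : ℕ) : ℝ) with hN1def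
    have hLn1 : (1 : ℝ) ≤ ((L ^ n : ℕ) : ℝ) := by exact_mod_cast Nat.one_le_pow n L (by omega)
    have hN1eq : N1 = ((L ^ n : ℕ) : ℝ) * L := by rw [hN1def]; push_cast; ring
    have hN1pos : 0 < N1 := by rw [hN1eq]; positivity
    have hL1c : ((L ^ 1 : ℕ) : ℝ) = L := by push_cast; ring
    have hr'0 : 0 ≤ r' := tdistT_nonneg _ x' y'
    have hr0 : 0 ≤ r := tdistT_nonneg _ u v
    -- the coarse run's single level in closed form
    have hc2 : Ca * ∑ i ∈ Finset.range 1, Λ ^ i * Real.exp (-(δa * (r * (L : ℝ) ^ i / ((L ^ 1 : ℕ) : ℝ))))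
        = Ca * Real.exp (-(δa * (r / L))) := by
      rw [Finset.sum_range_one, pow_zero, pow_zero, one_mul, mul_one, hL1c]
    have hcoarse' := hcoarse.trans hc2.le
    -- the coarse decay in the fine distance: `r′ ≤ L^n·r + (L^n − 1)` ⇒ `e^{−δa·r∕L} ≤ e^{δa}·e^{−δ·r′∕N1}`
    have hpair : r' ≤ ((L ^ n : ℕ) : ℝ) * r + (((L ^ n : ℕ) : ℝ) - 1) := tdistT_le_mul_underPtN L 1 n M x' y'
    have hexpc : Real.exp (-(δa * (r / L))) ≤ Real.exp δa * Real.exp (-(δ * (r' / N1))) := by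
      rw [← Real.exp_add]
      apply Real.exp_le_exp.mpr
      have h1 : r' / N1 ≤ r / L + 1 := by
        rw [div_le_iff₀ hN1pos, hN1eq]
        have e1 : (r / L + 1) * (((L ^ n : ℕ) : ℝ) * L) = ((L ^ n : ℕ) : ℝ) * r + ((L ^ n : ℕ) : ℝ) * L := by
          field_simp
        rw [e1]
        have e2 : ((L ^ n : ℕ) : ℝ) ≤ ((L ^ n : ℕ) : ℝ) * L := le_mul_of_one_le_right (by positivity) hLr
        linarith
      have h2 : δ * (r' / N1) ≤ δa * (r' / N1) := mul_le_mul_of_nonneg_right hδa' (div_nonneg hr'0 hN1pos.le)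
      have h3 : δa * (r' / N1) ≤ δa * (r / L + 1) := mul_le_mul_of_nonneg_left h1 hδa.le
      have h4 : δa * (r / L + 1) = δa * (r / L) + δa := by ring
      linarith
    -- monotonicity `δ ≤ δa` in the fine run's exponentials
    have hmono : ∀ s : ℝ, 0 ≤ s → Real.exp (-(δa * (r' * s / N1))) ≤ Real.exp (-(δ * (r' * s / N1))) := fun s hs =>
      Real.exp_le_exp.mpr (neg_le_neg (mul_le_mul_of_nonneg_right hδa' (by positivity)))
    -- split the fine run's level sum: level `0` + levels `1 … n`
    have hsplit : ∑ i ∈ Finset.range (1 + n), Λ ^ i * Real.exp (-(δa * (r' * (L : ℝ) ^ i / N1)))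
        = Real.exp (-(δa * (r' / N1)))
          + ∑ i ∈ Finset.range n, Λ ^ (i + 1) * Real.exp (-(δa * (r' * (L : ℝ) ^ (i + 1) / N1))) := by
      rw [show 1 + n = n + 1 by omega, Finset.sum_range_succ', pow_zero, pow_zero, one_mul, mul_one, add_comm]
    have hU : ∑ i ∈ Finset.range n, Λ ^ (i + 1) * Real.exp (-(δa * (r' * (L : ℝ) ^ (i + 1) / N1)))
        ≤ ∑ i ∈ Finset.range n, Λ ^ (1 + i) * Real.exp (-(δ * (r' * (L : ℝ) ^ (1 + i) / N1))) :=
      Finset.sum_le_sum fun i _ => by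
        rw [show i + 1 = 1 + i by omega]
        exact mul_le_mul_of_nonneg_left (hmono _ (by positivity)) (pow_nonneg hΛ.le _)
    have hU0 : 0 ≤ ∑ i ∈ Finset.range n, Λ ^ (1 + i) * Real.exp (-(δ * (r' * (L : ℝ) ^ (1 + i) / N1))) :=
      Finset.sum_nonneg fun i _ => by positivity
    have h0 : Real.exp (-(δa * (r' / N1))) ≤ Real.exp (-(δ * (r' / N1))) := by
      have h := hmono 1 zero_le_one
      rwa [mul_one] at h
    -- the paired constant: `Ca·(1 + e^{δa}) ≤ C·θ`
    have hCθ : Ca * (1 + Real.exp δa) ≤ C * θ := hspare _ (by positivity) hC1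
    have hE0 : 0 ≤ Real.exp (-(δ * (r' / N1))) := (Real.exp_pos _).le
    -- the target's paired sum at `K = 1` is the single term `e^{−δ r′∕N1}`
    rw [Finset.sum_range_one, pow_zero, pow_zero, one_mul, mul_one, pow_one θ]
    calc |((L ^ n * L ^ 1 : ℕ) : ℝ) *
              (constrainedProp (L ^ n * L ^ 1) M (aK a L (1 + n)) (((L ^ n * L ^ 1 : ℕ) : ℝ) ^ 2) msq
                  (x' + unitVec (fine (L ^ n * L ^ 1) M) μ) y'
                - constrainedProp (L ^ n * L ^ 1) M (aK a L (1 + n)) (((L ^ n * L ^ 1 : ℕ) : ℝ) ^ 2) msq x' y')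
            - ((L ^ 1 : ℕ) : ℝ) *
              (constrainedProp (L ^ 1) M (aK a L 1) (((L ^ 1 : ℕ) : ℝ) ^ 2) msq (u + unitVec (fine (L ^ 1) M) μ) v
                - constrainedProp (L ^ 1) M (aK a L 1) (((L ^ 1 : ℕ) : ℝ) ^ 2) msq u v)|
        ≤ |((L ^ n * L ^ 1 : ℕ) : ℝ) *
              (constrainedProp (L ^ n * L ^ 1) M (aK a L (1 + n)) (((L ^ n * L ^ 1 : ℕ) : ℝ) ^ 2) msq
                  (x' + unitVec (fine (L ^ n * L ^ 1) M) μ) y'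
                - constrainedProp (L ^ n * L ^ 1) M (aK a L (1 + n)) (((L ^ n * L ^ 1 : ℕ) : ℝ) ^ 2) msq x' y')|
            + |((L ^ 1 : ℕ) : ℝ) *
              (constrainedProp (L ^ 1) M (aK a L 1) (((L ^ 1 : ℕ) : ℝ) ^ 2) msq (u + unitVec (fine (L ^ 1) M) μ) v
                - constrainedProp (L ^ 1) M (aK a L 1) (((L ^ 1 : ℕ) : ℝ) ^ 2) msq u v)| := abs_sub _ _
      _ ≤ Ca * ∑ i ∈ Finset.range (1 + n), Λ ^ i * Real.exp (-(δa * (r' * (L : ℝ) ^ i / N1)))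
            + Ca * Real.exp (-(δa * (r / L))) := add_le_add hfine hcoarse'
      _ ≤ Ca * (Real.exp (-(δ * (r' / N1)))
              + ∑ i ∈ Finset.range n, Λ ^ (1 + i) * Real.exp (-(δ * (r' * (L : ℝ) ^ (1 + i) / N1))))
            + Ca * (Real.exp δa * Real.exp (-(δ * (r' / N1)))) := by
          rw [hsplit]
          exact add_le_add (mul_le_mul_of_nonneg_left (add_le_add h0 hU) hCa.le)
            (mul_le_mul_of_nonneg_left hexpc hCa.le)
      _ = Ca * (1 + Real.exp δa) * Real.exp (-(δ * (r' / N1)))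
            + Ca * ∑ i ∈ Finset.range n, Λ ^ (1 + i) * Real.exp (-(δ * (r' * (L : ℝ) ^ (1 + i) / N1))) := by ring
      _ ≤ C * θ * Real.exp (-(δ * (r' / N1)))
            + C * ∑ i ∈ Finset.range n, Λ ^ (1 + i) * Real.exp (-(δ * (r' * (L : ℝ) ^ (1 + i) / N1))) :=
          add_le_add (mul_le_mul_of_nonneg_right hCθ hE0) (mul_le_mul_of_nonneg_right hC2 hU0)
      _ = C * (θ * Real.exp (-(δ * (r' / N1)))
            + ∑ i ∈ Finset.range n, Λ ^ (1 + i) * Real.exp (-(δ * (r' * (L : ℝ) ^ (1 + i) / N1)))) := by ring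
  | succ K hK IH =>
    intro n hn e M _ hM msq hmsq hcap μ x'' y''
    -- the unit lattice IS the cube `M_e`
    obtain rfl : M = fun _ => 2 * L ^ e := funext hM
    -- the slice index of the peeled top slices and the nested coordinates of the fine points
    set i : KSliceIdx d := ⟨e, K, hK, n, hn, 0, Nat.zero_le e, 1, le_rfl⟩ with hidef
    have h : ∀ μ, fine (L ^ n * L ^ K * L) (ksM L i) μ = fine (L ^ n * L ^ (K + 1)) (ksM L i) μ :=
      fine_assoc L K n (ksM L i)
    obtain ⟨x₁, rfl⟩ := (torCongr h).surjective x''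
    obtain ⟨y₁, rfl⟩ := (torCongr h).surjective y''
    obtain ⟨x', rfl⟩ := (flatten (L ^ n * L ^ K) L (ksM L i)).surjective x₁
    obtain ⟨y', rfl⟩ := (flatten (L ^ n * L ^ K) L (ksM L i)).surjective y₁
    rw [underPtN_flatten L K n (ksM L i) h x', underPtN_flatten L K n (ksM L i) h y']
    -- the coarse points under `x′, y′` in the finer cube
    set x := underPtN L K n (ksU L i) x' with hxdef
    set y := underPtN L K n (ksU L i) y' with hydef
    -- the fine distance (preserved by both peels) and the coarse block distance one level down
    set r' : ℝ := tdistT (fine (L ^ n * L ^ K) (ksU L i)) x' y' with hr'def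
    set Dsub : ℝ := tdistT (ksU L i) (blockOf (L ^ K) (ksU L i) x) (blockOf (L ^ K) (ksU L i) y) with hDsubdef
    set NK : ℝ := ((L ^ n * L ^ K : ℕ) : ℝ) with hNKdef
    have hNK1 : 1 ≤ NK := by
      rw [hNKdef]
      exact_mod_cast Nat.one_le_iff_ne_zero.mpr (Nat.mul_ne_zero (pow_ne_zero _ (by omega)) (pow_ne_zero _ (by omega)))
    have hNK0 : 0 < NK := by linarith
    have hNKL : NK ≤ NK * L := le_mul_of_one_le_right hNK0.le hLr
    have hcastN : ((L ^ n * L ^ (K + 1) : ℕ) : ℝ) = NK * L := by rw [hNKdef]; push_cast; ring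
    have hr'0 : 0 ≤ r' := tdistT_nonneg _ x' y'
    -- `Dsub` read in fine distance: `B(x) = B(x′)` one level down, then part R-a §1
    have hDsub' : Dsub = tdistT (ksU L i) (blockOf (L ^ n * L ^ K) (ksU L i) x') (blockOf (L ^ n * L ^ K) (ksU L i) y') := by
      rw [hDsubdef, hxdef, hydef, blockOf_underPtN, blockOf_underPtN]
    have hfine : r' ≤ NK * Dsub + (NK - 1) := by
      rw [hDsub']
      exact tdistT_fine_le_blocks (L ^ n * L ^ K) (ksU L i) x' y'
    -- the mass one level down
    have hL2 : (0 : ℝ) < (L : ℝ) ^ 2 := by positivity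
    have hm2 : 0 < msq / (L : ℝ) ^ 2 := div_pos hmsq hL2
    have hm2cap : msq / (L : ℝ) ^ 2 ≤ m0sq := by
      have h1 : (1 : ℝ) ≤ (L : ℝ) ^ 2 := one_le_pow₀ hLr
      exact (div_le_self hmsq.le h1).trans hcap
    -- the induction hypothesis on the finer cube `fine L M_e = (2L^{e+1})` for the sub-pair, ALL pairs
    have hM' : ∀ μ, ksU L i μ = 2 * L ^ (e + 1) := fun μ => by
      show L * (2 * L ^ e) = 2 * L ^ (e + 1)
      ring
    have hIH := IH n hn (e + 1) (ksU L i) hM' (msq / (L : ℝ) ^ 2) hm2 hm2cap μ x' y'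
    -- abbreviations for the three level sums one level down
    set PS : ℝ := ∑ j ∈ Finset.range K, Λ' ^ j * Real.exp (-(δ * (r' * (L : ℝ) ^ j / NK))) with hPSdef
    set US : ℝ := ∑ j ∈ Finset.range n, Λ ^ (K + j) * Real.exp (-(δ * (r' * (L : ℝ) ^ (K + j) / NK))) with hUSdef
    have hPS0 : 0 ≤ PS := Finset.sum_nonneg fun j _ => by positivity
    have hUS0 : 0 ≤ US := Finset.sum_nonneg fun j _ => by positivity
    -- part M's slice rate, read in fine distance at the NEW top scale `NK·L`
    have hS : |ksDSlice' L a (msq / (L : ℝ) ^ 2) i μ x' y' - ksDSlice L a (msq / (L : ℝ) ^ 2) i μ x y|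
        ≤ Cr * θ ^ K * Real.exp (-(κ * Dsub)) := Hr (msq / (L : ℝ) ^ 2) hm2 hm2cap i μ x' y'
    have hexpS : Real.exp (-(κ * Dsub)) ≤ Real.exp κ * Real.exp (-(δ * (r' / (NK * L)))) :=
      exp_block_decay_le hNK1 hNKL hr'0 hδ.le hδκ hfine
    set E : ℝ := Real.exp (-(δ * (r' / (NK * L)))) with hEdef
    have hE0 : 0 ≤ E := (Real.exp_pos _).le
    have hS' : |ksDSlice' L a (msq / (L : ℝ) ^ 2) i μ x' y' - ksDSlice L a (msq / (L : ℝ) ^ 2) i μ x y|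
        ≤ Cr * Real.exp κ * θ ^ K * E := by
      calc |ksDSlice' L a (msq / (L : ℝ) ^ 2) i μ x' y' - ksDSlice L a (msq / (L : ℝ) ^ 2) i μ x y|
          ≤ Cr * θ ^ K * Real.exp (-(κ * Dsub)) := hS
        _ ≤ Cr * θ ^ K * (Real.exp κ * E) := mul_le_mul_of_nonneg_left hexpS (by positivity)
        _ = Cr * Real.exp κ * θ ^ K * E := by ring
    -- the pair of peels
    have hpeel := fullPropD_peel_pair_abs_le L hL ha hmsq i μ x' y' x y h
    -- the level sums of the target: paired `Σ_{j<K+1} = (j = 0) + Λ′·Σ_{j<K}(j ↦ j+1)`, unpaired `Λ·Σ`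
    have hshiftP : ∀ j : ℕ, Λ' ^ (j + 1) * Real.exp (-(δ * (r' * (L : ℝ) ^ (j + 1) / (NK * L))))
        = Λ' * (Λ' ^ j * Real.exp (-(δ * (r' * (L : ℝ) ^ j / NK)))) := fun j => by
      have he : r' * (L : ℝ) ^ (j + 1) / (NK * L) = r' * (L : ℝ) ^ j / NK := by
        rw [pow_succ, ← mul_assoc, mul_div_mul_right _ _ hL0.ne']
      rw [he, pow_succ]
      ring
    have hsumP : ∑ j ∈ Finset.range (K + 1), Λ' ^ j * Real.exp (-(δ * (r' * (L : ℝ) ^ j / (NK * L))))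
        = E + Λ' * PS := by
      rw [Finset.sum_range_succ', pow_zero, pow_zero, one_mul, mul_one, hPSdef, Finset.mul_sum, add_comm]
      congr 1
      exact Finset.sum_congr rfl fun j _ => hshiftP j
    have hshiftU : ∀ j : ℕ, Λ ^ (K + 1 + j) * Real.exp (-(δ * (r' * (L : ℝ) ^ (K + 1 + j) / (NK * L))))
        = Λ * (Λ ^ (K + j) * Real.exp (-(δ * (r' * (L : ℝ) ^ (K + j) / NK)))) := fun j => by
      have he : r' * (L : ℝ) ^ (K + j + 1) / (NK * L) = r' * (L : ℝ) ^ (K + j) / NK := by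
        rw [pow_succ, ← mul_assoc, mul_div_mul_right _ _ hL0.ne']
      rw [show K + 1 + j = K + j + 1 by omega, he, pow_succ]
      ring
    have hsumU : ∑ j ∈ Finset.range n, Λ ^ (K + 1 + j) * Real.exp (-(δ * (r' * (L : ℝ) ^ (K + 1 + j) / (NK * L))))
        = Λ * US := by
      rw [hUSdef, Finset.mul_sum]
      exact Finset.sum_congr rfl fun j _ => hshiftU j
    -- the bookkeeping `θ^{K+1}·Λ′ = θ^K·Λ` and the spare power for the top slice `Λ·Cr·e^κ ≤ C·θ`
    have hθpow : θ ^ (K + 1) * Λ' = θ ^ K * Λ := by rw [pow_succ, mul_assoc, hθΛ']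
    have hCθ : Λ * Cr * Real.exp κ ≤ C * θ := hspare _ (by positivity) hC3
    -- the goal's distance and casts, on the right-hand side only (the casts also sit inside `G`'s arguments)
    conv_rhs => rw [tdistT_torCongr h, tdistT_flatten, hcastN, ← hr'def, hsumP, hsumU]
    calc |((L ^ n * L ^ (K + 1) : ℕ) : ℝ) *
              (constrainedProp (L ^ n * L ^ (K + 1)) (ksM L i) (aK a L (K + 1 + n))
                  (((L ^ n * L ^ (K + 1) : ℕ) : ℝ) ^ 2) msq
                  (torCongr h (flatten (L ^ n * L ^ K) L (ksM L i) x') + unitVec (fine (L ^ n * L ^ (K + 1)) (ksM L i)) μ)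
                  (torCongr h (flatten (L ^ n * L ^ K) L (ksM L i) y'))
                - constrainedProp (L ^ n * L ^ (K + 1)) (ksM L i) (aK a L (K + 1 + n))
                  (((L ^ n * L ^ (K + 1) : ℕ) : ℝ) ^ 2) msq
                  (torCongr h (flatten (L ^ n * L ^ K) L (ksM L i) x')) (torCongr h (flatten (L ^ n * L ^ K) L (ksM L i) y')))
            - ((L ^ K * L : ℕ) : ℝ) *
              (constrainedProp (L ^ K * L) (ksM L i) (aK a L (K + 1)) (((L ^ K * L : ℕ) : ℝ) ^ 2) msq
                  (flatten (L ^ K) L (ksM L i) x + unitVec (fine (L ^ K * L) (ksM L i)) μ) (flatten (L ^ K) L (ksM L i) y)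
                - constrainedProp (L ^ K * L) (ksM L i) (aK a L (K + 1)) (((L ^ K * L : ℕ) : ℝ) ^ 2) msq
                  (flatten (L ^ K) L (ksM L i) x) (flatten (L ^ K) L (ksM L i) y))|
        ≤ Λ * (|((L ^ n * L ^ K : ℕ) : ℝ) *
                  (constrainedProp (L ^ n * L ^ K) (ksU L i) (aK a L (K + n)) (((L ^ n * L ^ K : ℕ) : ℝ) ^ 2)
                      (msq / (L : ℝ) ^ 2) (x' + unitVec (fine (L ^ n * L ^ K) (ksU L i)) μ) y'
                    - constrainedProp (L ^ n * L ^ K) (ksU L i) (aK a L (K + n)) (((L ^ n * L ^ K : ℕ) : ℝ) ^ 2)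
                      (msq / (L : ℝ) ^ 2) x' y')
                - ((L ^ K : ℕ) : ℝ) *
                  (constrainedProp (L ^ K) (ksU L i) (aK a L K) (((L ^ K : ℕ) : ℝ) ^ 2) (msq / (L : ℝ) ^ 2)
                      (x + unitVec (fine (L ^ K) (ksU L i)) μ) y
                    - constrainedProp (L ^ K) (ksU L i) (aK a L K) (((L ^ K : ℕ) : ℝ) ^ 2) (msq / (L : ℝ) ^ 2) x y)|
              + |ksDSlice' L a (msq / (L : ℝ) ^ 2) i μ x' y' - ksDSlice L a (msq / (L : ℝ) ^ 2) i μ x y|) := hpeel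
      _ ≤ Λ * (C * (θ ^ K * PS + US) + Cr * Real.exp κ * θ ^ K * E) :=
          mul_le_mul_of_nonneg_left (add_le_add hIH hS') hΛ.le
      _ = C * (θ ^ K * Λ) * PS + C * (Λ * US) + (Λ * Cr * Real.exp κ) * θ ^ K * E := by ring
      _ ≤ C * (θ ^ K * Λ) * PS + C * (Λ * US) + (C * θ) * θ ^ K * E := by
          have := mul_le_mul_of_nonneg_right (mul_le_mul_of_nonneg_right hCθ (pow_nonneg hθ0.le K)) hE0
          linarith
      _ = C * (θ ^ (K + 1) * (E + Λ' * PS) + Λ * US) := by rw [← hθpow, pow_succ]; ring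

end Summit.QuantumFields.YangMills.BalabanUVNodes.N15KingModelRung.Curved
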